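import Literature.NumberTheory.EllipticCurves.PAdicBSDMemIwasawaRatProofs
import HarnessLib

/-!
# The `p`-adic Mellin transform of a bounded `ℚ_p`-valued distribution on `ℤ_p^×`

Mazur–Tate–Teitelbaum (Invent. Math. 84 (1986), §I.11–I.14) attach to every bounded
`ℚ_p`-valued distribution `μ` on `ℤ_p` (a *measure*) the power series
`L_μ(T) = ∫_{ℤ_p^×} (1 + T)^{ℓ(x)} dμ(x) ∈ Λ ⊗ ℚ_p` (`⟨x⟩ = γ^{ℓ(x)}`, `γ = 1 + p^{e₀}` the
topological generator of `1 + p^{e₀}ℤ_p`, `e₀ = 1` for odd `p` and `2` for `p = 2`), whose values at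
`T = χ(γ) - 1` for the characters `χ` of `Γ = ℤ_p^× / μ_τ` of conductor `p^m`, `m ≥ 1`, are the
"Gauss sums" `∫ χ dμ = ∑_{a mod p^m} χ(a) μ(a + p^m ℤ_p)` (MTT §I.13, formula for `L_p(P, χ)`;
§I.14, (14.3)), and whose constant term is `μ(ℤ_p^×)`.

`Literature.NumberTheory.EllipticCurves.PAdicLFunctionInterpolationProofs` carried this out for the
Mazur–Swinnerton-Dyer measure `msdMeasure f α` of a good ordinary prime. This file redoes the same
`p`-adic analysis for an **abstract** set function `μ : (n : ℕ) → ℤ/p^n → ℚ_p` subject only to the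
distribution relation `∑_{b ≡ a (p^n)} μ(b + p^{n+1}ℤ_p) = μ(a + p^nℤ_p)` and a bound
`‖μ(a + p^nℤ_p)‖ ≤ C`, so that it can be applied to the measure `μ(a + p^nℤ_p) = [a/p^n]⁺_f` of a
prime of split multiplicative reduction (`PAdicBSD`, `IsSplitMultPAdicLFunctionOf`; MTT §I.10 with
`ε(p) = 0`, `α = a_p = 1`), which is *not* of the form `msdMeasure f α`.

## Main result (no new definitions are introduced; the transform is produced existentially)

* `exists_powerSeries_of_bounded_distribution`: for such `μ` there is `L ∈ ℚ_p⟦T⟧` with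
  (i) `‖[T^k] L‖ ≤ C` for all `k` (so `L ∈ Λ ⊗ ℚ_p`, `memIwasawaRat_of_forall_norm_coeff_le`);
  (ii) `L(0) = ∑_{u ∈ (ℤ/p^{e₀})^×} μ(u + p^{e₀}ℤ_p) = μ(ℤ_p^×)`;
  (iii) for every `m` and every Dirichlet character `χ` mod `p^{m+1}` with values in `ℂ_p` that is
  a character of `Γ` (even and of `p`-power order),
  `∑_k [T^k]L · (χ(γ) - 1)^k = ∑_{a mod p^{m+1}} χ(a) μ(a + p^{m+1}ℤ_p)` in `ℂ_p`.
  The coefficients of `L` are the limits of the Riemann sums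
  `∑_η ∑_{s mod p^n} μ(η γ^s + p^{n+e₀}ℤ_p) (s choose k)` (`η` over the Teichmüller
  representatives),
  i.e. `[T^k]L = ∫_{ℤ_p^×} (ℓ(x) choose k) dμ`.

The intermediate lemmas (`sum_fiber_of_distribution`, `sum_units_mul_of_distribution`,
`riemannSum_zero_of_distribution`, `finsum_sum_mul_pow_eq_of_distribution`,
`hasSum_riemannSum_mul_pow`, `norm_riemannSum_succ_sub_le_of_distribution`, …) are the abstract
forms of the corresponding lemmas of `PAdicLFunctionInterpolationProofs`, with the same proofs; the
Riemann sums enter through a function `RS : ℕ → ℕ → ℚ_p` constrained by the hypothesis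
`hRS : RS k n = ∑_η ∑_s μ(η γ^s + p^{n+e₀}ℤ_p) (s choose k)`.

## References

* B. Mazur, J. Tate, J. Teitelbaum, *On `p`-adic analogues of the conjectures of Birch and
  Swinnerton-Dyer*, Invent. Math. 84 (1986), 1–48, §I.11 (measures), §I.12 (`Λ ⊗ ℚ` = bounded
  power series), §I.13 (the `p`-adic multiplier, `L_p(P, χ)`), §I.14 (14.3).
* B. Mazur, P. Swinnerton-Dyer, *Arithmetic of Weil curves*, Invent. Math. 25 (1974), §8–§9.
* L. C. Washington, *Introduction to cyclotomic fields*, GTM 83, §7.2, §12.2.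
-/

noncomputable section

open Filter Topology

namespace Literature.NumberTheory.EllipticCurves

variable {p : ℕ} [Fact p.Prime]

/-! ### Iterating the distribution relation -/

section Distribution

variable {μ : (n : ℕ) → ZMod (p ^ n) → ℚ_[p]}

/-- **Iterated distribution relation**: `∑_{b ≡ a mod p^n} μ(b + p^L ℤ_p) = μ(a + p^n ℤ_p)` for
`n ≤ L`, from the one-step relation (Mazur–Tate–Teitelbaum 1986, §I.11, (11.1)). [folklore] -/
theorem sum_fiber_of_distribution
    (hdist : ∀ (n : ℕ) (a : ZMod (p ^ n)),
      ∑ b ∈ Finset.univ.filter (fun b : ZMod (p ^ (n + 1)) ↦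
        ZMod.castHom (pow_dvd_pow p n.le_succ) (ZMod (p ^ n)) b = a), μ (n + 1) b = μ n a)
    {n L : ℕ} (h : n ≤ L) (a : ZMod (p ^ n)) :
    ∑ b ∈ Finset.univ.filter (fun b : ZMod (p ^ L) ↦
      ZMod.castHom (pow_dvd_pow p h) (ZMod (p ^ n)) b = a), μ L b = μ n a := by
  classical
  induction L, h using Nat.le_induction with
  | base =>
    rw [ZMod.castHom_self]
    simp [Finset.filter_eq']
  | succ L hL ih =>
    rw [← ih, ← Finset.sum_fiberwise_of_maps_to
      (s := Finset.univ.filter (fun b : ZMod (p ^ (L + 1)) ↦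
        ZMod.castHom (pow_dvd_pow p (hL.trans L.le_succ)) (ZMod (p ^ n)) b = a))
      (t := Finset.univ.filter (fun b : ZMod (p ^ L) ↦
        ZMod.castHom (pow_dvd_pow p hL) (ZMod (p ^ n)) b = a))
      (g := ZMod.castHom (pow_dvd_pow p L.le_succ) (ZMod (p ^ L)))]
    · refine Finset.sum_congr rfl fun y hy ↦ ?_
      rw [← hdist L y]
      refine Finset.sum_congr ?_ fun _ _ ↦ rfl
      ext x
      simp only [Finset.mem_filter, Finset.mem_univ, true_and, and_iff_right_iff_imp]
      intro hx
      rw [← (Finset.mem_filter.mp hy).2, ← hx, castHom_castHom_zmod]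
    · intro x hx
      simp only [Finset.mem_filter, Finset.mem_univ, true_and] at hx ⊢
      rw [castHom_castHom_zmod]
      exact hx

/-- **From level `p^L` down to level `p^m` on units**: for `1 ≤ m ≤ L`, a ring homomorphism
`ι : ℚ_p → R` and `g : ℤ/p^m → R`,
`∑_{u ∈ (ℤ/p^L)^×} ι(μ(u + p^L)) g(u mod p^m) = ∑_{a ∈ (ℤ/p^m)^×} ι(μ(a + p^m)) g(a)`
(group the units modulo `p^L` by their residue modulo `p^m`, again a unit, and use the iterated
distribution relation) (Mazur–Tate–Teitelbaum 1986, §I.11–I.13). [folklore] -/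
theorem sum_units_mul_of_distribution
    (hdist : ∀ (n : ℕ) (a : ZMod (p ^ n)),
      ∑ b ∈ Finset.univ.filter (fun b : ZMod (p ^ (n + 1)) ↦
        ZMod.castHom (pow_dvd_pow p n.le_succ) (ZMod (p ^ n)) b = a), μ (n + 1) b = μ n a)
    {R : Type*} [CommRing R] (ι : ℚ_[p] →+* R) {m L : ℕ} (hm : 1 ≤ m) (h : m ≤ L)
    (g : ZMod (p ^ m) → R) :
    ∑ u : (ZMod (p ^ L))ˣ, ι (μ L u) * g (ZMod.castHom (pow_dvd_pow p h) (ZMod (p ^ m)) u) =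
      ∑ a : (ZMod (p ^ m))ˣ, ι (μ m a) * g a := by
  classical
  haveI : NeZero (p ^ L) := ⟨pow_ne_zero _ (Fact.out : p.Prime).ne_zero⟩
  haveI : NeZero (p ^ m) := ⟨pow_ne_zero _ (Fact.out : p.Prime).ne_zero⟩
  rw [sum_units_eq_sum_filter_isUnit (F := fun b : ZMod (p ^ L) ↦ ι (μ L b) *
      g (ZMod.castHom (pow_dvd_pow p h) (ZMod (p ^ m)) b)),
    sum_units_eq_sum_filter_isUnit (F := fun a : ZMod (p ^ m) ↦ ι (μ m a) * g a),
    ← Finset.sum_fiberwise (Finset.univ.filter fun b : ZMod (p ^ L) ↦ IsUnit b)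
      (ZMod.castHom (pow_dvd_pow p h) (ZMod (p ^ m))), Finset.sum_filter]
  refine Finset.sum_congr rfl fun a _ ↦ ?_
  split_ifs with ha
  · have hfil : (Finset.univ.filter fun b : ZMod (p ^ L) ↦ IsUnit b).filter
        (fun b ↦ ZMod.castHom (pow_dvd_pow p h) (ZMod (p ^ m)) b = a) =
        Finset.univ.filter (fun b ↦ ZMod.castHom (pow_dvd_pow p h) (ZMod (p ^ m)) b = a) := by
      ext b
      simp only [Finset.mem_filter, Finset.mem_univ, true_and, and_iff_right_iff_imp]
      intro hb
      rw [isUnit_iff_isUnit_castHom hm h, hb]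
      exact ha
    rw [hfil, ← sum_fiber_of_distribution hdist h a, map_sum, Finset.sum_mul]
    refine Finset.sum_congr rfl fun b hb ↦ ?_
    rw [(Finset.mem_filter.mp hb).2]
  · refine Finset.sum_eq_zero fun b hb ↦ ?_
    simp only [Finset.mem_filter, Finset.mem_univ, true_and] at hb
    exact absurd (hb.2 ▸ (isUnit_iff_isUnit_castHom hm h b).mp hb.1) ha

/-- **The Riemann sums against a character of `Γ` are a Gauss sum of `μ`**: for `χ` mod `p^m`,
`1 ≤ m`, even and of `p`-power order, and `m ≤ n + e₀`,
`∑_η ∑_{s mod p^n} μ(η γ^s + p^{n+e₀}) χ(γ)^s = ∑_{a mod p^m} χ(a) μ(a + p^m ℤ_p)`: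
`χ(γ)^s = χ(η γ^s mod p^m)` (`χ(η) = 1`, `apply_toZModPow_rootsOfUnity`), the classes `η γ^s` run
over `(ℤ/p^{n+e₀})^×`, and the sum descends to level `p^m` by the distribution relation, where `χ`
vanishes off the units (Mazur–Tate–Teitelbaum 1986, §I.13, the formula for `L_p(P, χ)`).
[folklore] -/
theorem finsum_sum_mul_pow_eq_of_distribution
    (hdist : ∀ (n : ℕ) (a : ZMod (p ^ n)),
      ∑ b ∈ Finset.univ.filter (fun b : ZMod (p ^ (n + 1)) ↦
        ZMod.castHom (pow_dvd_pow p n.le_succ) (ZMod (p ^ n)) b = a), μ (n + 1) b = μ n a)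
    {m : ℕ} (hm : 1 ≤ m) (χ : DirichletCharacter ℂ_[p] (p ^ m)) (heven : χ.Even)
    (hord : ∃ j : ℕ, orderOf χ = p ^ j) {n : ℕ} (hn : m ≤ n + cyclotomicExponent p) :
    ∑ᶠ η : rootsOfUnity (torsionOrder p) ℤ_[p], ∑ s : ZMod (p ^ n),
        algebraMap ℚ_[p] ℂ_[p] (μ (n + cyclotomicExponent p)
          (PadicInt.toZModPow (n + cyclotomicExponent p) ((η : ℤ_[p]ˣ) : ℤ_[p]) *
            (cyclotomicGenerator p : ZMod (p ^ (n + cyclotomicExponent p))) ^ s.val)) *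
          χ (cyclotomicGenerator p : ZMod (p ^ m)) ^ s.val =
      ∑ a : ZMod (p ^ m), χ a * algebraMap ℚ_[p] ℂ_[p] (μ m a) := by
  classical
  haveI : NeZero (p ^ m) := ⟨pow_ne_zero _ (Fact.out : p.Prime).ne_zero⟩
  have hpt : ∀ (η : rootsOfUnity (torsionOrder p) ℤ_[p]) (s : ZMod (p ^ n)),
      χ (cyclotomicGenerator p : ZMod (p ^ m)) ^ s.val =
        χ (ZMod.castHom (pow_dvd_pow p hn) (ZMod (p ^ m))
          (PadicInt.toZModPow (n + cyclotomicExponent p) ((η : ℤ_[p]ˣ) : ℤ_[p]) *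
            (cyclotomicGenerator p : ZMod (p ^ (n + cyclotomicExponent p))) ^ s.val)) := by
    intro η s
    rw [map_mul, map_pow, map_natCast (ZMod.castHom (pow_dvd_pow p hn) (ZMod (p ^ m))),
      ZMod.castHom_apply, PadicInt.cast_toZModPow _ _ hn, map_mul, map_pow,
      apply_toZModPow_rootsOfUnity χ heven hord η, one_mul]
  calc _ = ∑ᶠ η : rootsOfUnity (torsionOrder p) ℤ_[p], ∑ s : ZMod (p ^ n),
        (fun b : ZMod (p ^ (n + cyclotomicExponent p)) ↦
          algebraMap ℚ_[p] ℂ_[p] (μ (n + cyclotomicExponent p) b) *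
            χ (ZMod.castHom (pow_dvd_pow p hn) (ZMod (p ^ m)) b))
          (PadicInt.toZModPow (n + cyclotomicExponent p) ((η : ℤ_[p]ˣ) : ℤ_[p]) *
            (cyclotomicGenerator p : ZMod (p ^ (n + cyclotomicExponent p))) ^ s.val) := by
          refine finsum_congr fun η ↦ Finset.sum_congr rfl fun s _ ↦ ?_
          rw [hpt η s]
    _ = ∑ u : (ZMod (p ^ (n + cyclotomicExponent p)))ˣ,
          algebraMap ℚ_[p] ℂ_[p] (μ (n + cyclotomicExponent p) u) *
            χ (ZMod.castHom (pow_dvd_pow p hn) (ZMod (p ^ m)) u) :=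
          finsum_sum_classes_eq_sum_units p n
            (fun b : ZMod (p ^ (n + cyclotomicExponent p)) ↦
              algebraMap ℚ_[p] ℂ_[p] (μ (n + cyclotomicExponent p) b) *
                χ (ZMod.castHom (pow_dvd_pow p hn) (ZMod (p ^ m)) b))
    _ = ∑ a : (ZMod (p ^ m))ˣ, algebraMap ℚ_[p] ℂ_[p] (μ m a) * χ a :=
          sum_units_mul_of_distribution hdist _ hm hn (fun a ↦ χ a)
    _ = ∑ a : ZMod (p ^ m), χ a * algebraMap ℚ_[p] ℂ_[p] (μ m a) := by
          rw [sum_units_eq_sum_filter_isUnit (F := fun a : ZMod (p ^ m) ↦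
            algebraMap ℚ_[p] ℂ_[p] (μ m a) * χ a), Finset.sum_filter]
          refine Finset.sum_congr rfl fun a _ ↦ ?_
          split_ifs with ha
          · exact mul_comm _ _
          · rw [MulChar.map_nonunit χ ha, zero_mul]

end Distribution

/-! ### The Riemann sums `RS k n = ∑_η ∑_{s mod p^n} μ(η γ^s + p^{n+e₀}ℤ_p) (s choose k)` -/

section RiemannSums

variable {μ : (n : ℕ) → ZMod (p ^ n) → ℚ_[p]} {RS : ℕ → ℕ → ℚ_[p]}
  (hRS : ∀ k n : ℕ, RS k n =
      ∑ᶠ η : rootsOfUnity (torsionOrder p) ℤ_[p], ∑ s : ZMod (p ^ n),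
        μ (n + cyclotomicExponent p)
            (PadicInt.toZModPow (n + cyclotomicExponent p) ((η : ℤ_[p]ˣ) : ℤ_[p]) *
              (cyclotomicGenerator p : ZMod (p ^ (n + cyclotomicExponent p))) ^ s.val) *
          ((s.val.choose k : ℕ) : ℚ_[p]))

include hRS

/-- **The Riemann sums for the constant term are constant**: `RS 0 n = μ(ℤ_p^×) =
∑_{u ∈ (ℤ/p^{e₀})^×} μ(u + p^{e₀}ℤ_p)` for every `n` — the classes `η γ^s mod p^{n+e₀}` run over
`(ℤ/p^{n+e₀})^×` exactly once (`finsum_sum_classes_eq_sum_units`) and the sum descends to level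
`p^{e₀}` along the distribution relation (Mazur–Tate–Teitelbaum 1986, §I.13). [folklore] -/
theorem riemannSum_zero_of_distribution
    (hdist : ∀ (n : ℕ) (a : ZMod (p ^ n)),
      ∑ b ∈ Finset.univ.filter (fun b : ZMod (p ^ (n + 1)) ↦
        ZMod.castHom (pow_dvd_pow p n.le_succ) (ZMod (p ^ n)) b = a), μ (n + 1) b = μ n a)
    (n : ℕ) :
    RS 0 n = ∑ u : (ZMod (p ^ cyclotomicExponent p))ˣ, μ (cyclotomicExponent p) u := by
  rw [hRS]
  simp only [Nat.choose_zero_right, Nat.cast_one, mul_one]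
  rw [finsum_sum_classes_eq_sum_units p n (μ (n + cyclotomicExponent p))]
  have h := sum_units_mul_of_distribution hdist (RingHom.id ℚ_[p])
    (m := cyclotomicExponent p) (L := n + cyclotomicExponent p)
    (Nat.pos_of_ne_zero (cyclotomicExponent_ne_zero p)) (Nat.le_add_left _ _) (fun _ ↦ 1)
  simpa only [RingHom.id_apply, mul_one] using h

/-- The Riemann sums `RS k n` vanish for `k ≥ p^n` (all `s < p^n`, so `(s choose k) = 0`).
[folklore] -/
theorem riemannSum_eq_zero_of_le {k n : ℕ} (hk : p ^ n ≤ k) : RS k n = 0 := by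
  haveI : NeZero (p ^ n) := ⟨pow_ne_zero _ (Fact.out : p.Prime).ne_zero⟩
  rw [hRS]
  apply finsum_eq_zero_of_forall_eq_zero
  intro η
  refine Finset.sum_eq_zero fun s _ ↦ ?_
  rw [Nat.choose_eq_zero_of_lt ((ZMod.val_lt s).trans_le hk), Nat.cast_zero, mul_zero]

/-- **Binomial expansion of the Riemann sums**: for every `T ∈ ℂ_p` and level `n`,
`∑_k RS k n T^k = ∑_η ∑_{s mod p^n} μ(η γ^s + p^{n+e₀}) (1 + T)^s` (a finite sum), i.e. the
Riemann sums of `∫ (ℓ(x) choose k) dμ` are the coefficients of the Riemann sums of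
`∫ (1 + T)^{ℓ(x)} dμ` (Mazur–Tate–Teitelbaum 1986, §I.13). [folklore] -/
theorem hasSum_riemannSum_mul_pow (n : ℕ) (T : ℂ_[p]) :
    HasSum (fun k : ℕ ↦ algebraMap ℚ_[p] ℂ_[p] (RS k n) * T ^ k)
      (∑ᶠ η : rootsOfUnity (torsionOrder p) ℤ_[p], ∑ s : ZMod (p ^ n),
        algebraMap ℚ_[p] ℂ_[p] (μ (n + cyclotomicExponent p)
          (PadicInt.toZModPow (n + cyclotomicExponent p) ((η : ℤ_[p]ˣ) : ℤ_[p]) *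
            (cyclotomicGenerator p : ZMod (p ^ (n + cyclotomicExponent p))) ^ s.val)) *
          (1 + T) ^ s.val) := by
  classical
  haveI := neZero_torsionOrder p
  haveI := Fintype.ofFinite (rootsOfUnity (torsionOrder p) ℤ_[p])
  haveI : NeZero (p ^ n) := ⟨pow_ne_zero _ (Fact.out : p.Prime).ne_zero⟩
  have hzero : ∀ k ∉ Finset.range (p ^ n), algebraMap ℚ_[p] ℂ_[p] (RS k n) * T ^ k = 0 := by
    intro k hk
    rw [Finset.mem_range, not_lt] at hk
    rw [riemannSum_eq_zero_of_le hRS hk, map_zero, zero_mul]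
  have key : ∑ k ∈ Finset.range (p ^ n), algebraMap ℚ_[p] ℂ_[p] (RS k n) * T ^ k =
      ∑ᶠ η : rootsOfUnity (torsionOrder p) ℤ_[p], ∑ s : ZMod (p ^ n),
        algebraMap ℚ_[p] ℂ_[p] (μ (n + cyclotomicExponent p)
          (PadicInt.toZModPow (n + cyclotomicExponent p) ((η : ℤ_[p]ˣ) : ℤ_[p]) *
            (cyclotomicGenerator p : ZMod (p ^ (n + cyclotomicExponent p))) ^ s.val)) *
          (1 + T) ^ s.val := by
    simp only [hRS, finsum_eq_sum_of_fintype, map_sum, map_mul, map_natCast, Finset.sum_mul]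
    rw [Finset.sum_comm]
    refine Finset.sum_congr rfl fun η _ ↦ ?_
    rw [Finset.sum_comm]
    refine Finset.sum_congr rfl fun s _ ↦ ?_
    rw [← sum_range_choose_mul_pow T (ZMod.val_lt s), Finset.mul_sum]
    refine Finset.sum_congr rfl fun k _ ↦ ?_
    ring
  rw [← key]
  exact hasSum_sum_of_ne_finset_zero hzero

/-- **The Riemann sums of a bounded `μ` are bounded by the same constant**: the summands
`μ(η γ^s + p^{n+e₀}) (s choose k)` have norm `≤ C` and `ℚ_p` is non-archimedean. [folklore] -/
theorem norm_riemannSum_le {C : ℝ} (hC : ∀ (n : ℕ) (a : ZMod (p ^ n)), ‖μ n a‖ ≤ C) (k n : ℕ) :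
    ‖RS k n‖ ≤ C := by
  classical
  haveI := neZero_torsionOrder p
  haveI := Fintype.ofFinite (rootsOfUnity (torsionOrder p) ℤ_[p])
  have hC0 : 0 ≤ C := (norm_nonneg _).trans (hC 0 0)
  rw [hRS, finsum_eq_sum_of_fintype]
  refine IsUltrametricDist.norm_sum_le_of_forall_le_of_nonneg hC0 fun η _ ↦ ?_
  refine IsUltrametricDist.norm_sum_le_of_forall_le_of_nonneg hC0 fun s _ ↦ ?_
  have h := Padic.norm_int_le_one (p := p) ((s.val.choose k : ℕ) : ℤ)
  rw [Int.cast_natCast] at h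
  rw [norm_mul]
  calc _ ≤ C * 1 := mul_le_mul (hC _ _) h (norm_nonneg _) hC0
    _ = C := mul_one C

/-- **The Riemann sums are Cauchy, at a geometric rate**: if `μ` satisfies the distribution
relation and `‖μ‖ ≤ C`, then `‖RS k (n+1) - RS k n‖ ≤ (C / ‖k!‖) p^{-n}`. Both sums live on
`(ℤ/p^{n+1+e₀})^×` after refining `RS k n` along the distribution relation; a class `u'`
contributes `μ(u') ((s' choose k) - (s choose k))` where `s' ≡ s mod p^n` are its `γ`-exponents at
the two levels, and `‖(s' choose k) - (s choose k)‖ ≤ p^{-n}/‖k!‖` (`norm_choose_sub_choose_le`)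
(Mazur–Tate–Teitelbaum 1986, §I.11: integration of the continuous function `x ↦ (ℓ(x) choose k)`
against the measure `μ`). [folklore] -/
theorem norm_riemannSum_succ_sub_le_of_distribution
    (hdist : ∀ (n : ℕ) (a : ZMod (p ^ n)),
      ∑ b ∈ Finset.univ.filter (fun b : ZMod (p ^ (n + 1)) ↦
        ZMod.castHom (pow_dvd_pow p n.le_succ) (ZMod (p ^ n)) b = a), μ (n + 1) b = μ n a)
    {C : ℝ} (hC0 : 0 ≤ C) (hC : ∀ (n : ℕ) (a : ZMod (p ^ n)), ‖μ n a‖ ≤ C) (k n : ℕ) :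
    ‖RS k (n + 1) - RS k n‖ ≤ C / ‖((k.factorial : ℕ) : ℚ_[p])‖ * (p : ℝ) ^ (-n : ℤ) := by
  classical
  haveI := neZero_torsionOrder p
  haveI := Fintype.ofFinite (rootsOfUnity (torsionOrder p) ℤ_[p])
  haveI : NeZero (p ^ n) := ⟨pow_ne_zero _ (Fact.out : p.Prime).ne_zero⟩
  haveI : NeZero (p ^ (n + 1)) := ⟨pow_ne_zero _ (Fact.out : p.Prime).ne_zero⟩
  -- the bijections `(η, s) ↦ η γ^s` at levels `n + e₀` and `n + 1 + e₀`
  set Φ : rootsOfUnity (torsionOrder p) ℤ_[p] × ZMod (p ^ n) →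
      (ZMod (p ^ (n + cyclotomicExponent p)))ˣ := fun x ↦ (isUnit_classMap p n x).unit with hΦ_def
  set Φ' : rootsOfUnity (torsionOrder p) ℤ_[p] × ZMod (p ^ (n + 1)) →
      (ZMod (p ^ (n + 1 + cyclotomicExponent p)))ˣ := fun x ↦ (isUnit_classMap p (n + 1) x).unit
    with hΦ'_def
  have hΦval : ∀ x, (Φ x : ZMod (p ^ (n + cyclotomicExponent p))) =
      PadicInt.toZModPow (n + cyclotomicExponent p) ((x.1 : ℤ_[p]ˣ) : ℤ_[p]) *
        (cyclotomicGenerator p : ZMod (p ^ (n + cyclotomicExponent p))) ^ x.2.val := fun x ↦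
    IsUnit.unit_spec _
  have hΦ'val : ∀ x, (Φ' x : ZMod (p ^ (n + 1 + cyclotomicExponent p))) =
      PadicInt.toZModPow (n + 1 + cyclotomicExponent p) ((x.1 : ℤ_[p]ˣ) : ℤ_[p]) *
        (cyclotomicGenerator p : ZMod (p ^ (n + 1 + cyclotomicExponent p))) ^ x.2.val := fun x ↦
    IsUnit.unit_spec _
  have hΦinj : Function.Injective Φ := fun x y hxy ↦ classMap_injective p n (by
    have h := congr_arg Units.val hxy
    rwa [hΦval, hΦval] at h)
  have hΦ'inj : Function.Injective Φ' := fun x y hxy ↦ classMap_injective p (n + 1) (by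
    have h := congr_arg Units.val hxy
    rwa [hΦ'val, hΦ'val] at h)
  have hΦbij : Function.Bijective Φ :=
    (Fintype.bijective_iff_injective_and_card Φ).mpr ⟨hΦinj, card_classDomain p n⟩
  have hΦ'bij : Function.Bijective Φ' :=
    (Fintype.bijective_iff_injective_and_card Φ').mpr ⟨hΦ'inj, card_classDomain p (n + 1)⟩
  set E := Equiv.ofBijective Φ hΦbij with hE_def
  set E' := Equiv.ofBijective Φ' hΦ'bij with hE'_def
  -- the `γ`-exponent functions `(ℓ(·) choose k)`, extended by `0` to non-units
  set g : ZMod (p ^ (n + cyclotomicExponent p)) → ℚ_[p] := fun b ↦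
    if h : IsUnit b then (((E.symm h.unit).2.val.choose k : ℕ) : ℚ_[p]) else 0 with hg_def
  set g' : ZMod (p ^ (n + 1 + cyclotomicExponent p)) → ℚ_[p] := fun b ↦
    if h : IsUnit b then (((E'.symm h.unit).2.val.choose k : ℕ) : ℚ_[p]) else 0 with hg'_def
  have hgΦ : ∀ x, g (Φ x) = ((x.2.val.choose k : ℕ) : ℚ_[p]) := by
    intro x
    rw [hg_def]
    dsimp only
    rw [dif_pos (Units.isUnit _), IsUnit.unit_of_val_units]
    simp [hE_def]
  have hg'Φ' : ∀ x, g' (Φ' x) = ((x.2.val.choose k : ℕ) : ℚ_[p]) := by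
    intro x
    rw [hg'_def]
    dsimp only
    rw [dif_pos (Units.isUnit _), IsUnit.unit_of_val_units]
    simp [hE'_def]
  -- `RS(k, n) = ∑_{u ∈ (ℤ/p^{n+e₀})^×} μ(u) g(u)` and similarly at level `n + 1`
  have hRSn : RS k n =
      ∑ u : (ZMod (p ^ (n + cyclotomicExponent p)))ˣ, μ (n + cyclotomicExponent p) u * g u := by
    rw [hRS, ← finsum_sum_classes_eq_sum_units p n (fun b ↦ μ (n + cyclotomicExponent p) b * g b)]
    refine finsum_congr fun η ↦ Finset.sum_congr rfl fun s _ ↦ ?_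
    rw [← hΦval (η, s), hgΦ]
  have hRSn' : RS k (n + 1) =
      ∑ u : (ZMod (p ^ (n + 1 + cyclotomicExponent p)))ˣ,
        μ (n + 1 + cyclotomicExponent p) u * g' u := by
    rw [hRS, ← finsum_sum_classes_eq_sum_units p (n + 1)
      (fun b ↦ μ (n + 1 + cyclotomicExponent p) b * g' b)]
    refine finsum_congr fun η ↦ Finset.sum_congr rfl fun s _ ↦ ?_
    rw [← hΦ'val (η, s), hg'Φ']
  -- refine `RS(k, n)` to level `n + 1 + e₀` along the distribution relation
  have hle : n + cyclotomicExponent p ≤ n + 1 + cyclotomicExponent p := by omega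
  have hdesc := sum_units_mul_of_distribution hdist (RingHom.id ℚ_[p])
    (m := n + cyclotomicExponent p) (L := n + 1 + cyclotomicExponent p)
    (le_add_of_le_right (Nat.pos_of_ne_zero (cyclotomicExponent_ne_zero p))) hle g
  simp only [RingHom.id_apply] at hdesc
  rw [hRSn, hRSn', ← hdesc, ← Finset.sum_sub_distrib]
  -- termwise estimate
  have hp1 : (1 : ℝ) < p := by exact_mod_cast (Fact.out : p.Prime).one_lt
  refine IsUltrametricDist.norm_sum_le_of_forall_le_of_nonneg (by positivity) fun u' _ ↦ ?_
  obtain ⟨⟨θ, s'⟩, hx'⟩ := hΦ'bij.2 u'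
  have hpow : (cyclotomicGenerator p : ZMod (p ^ (n + cyclotomicExponent p))) ^ (s'.val % p ^ n) =
      (cyclotomicGenerator p : ZMod (p ^ (n + cyclotomicExponent p))) ^ s'.val := by
    have h := pow_mod_orderOf (cyclotomicGenerator p : ZMod (p ^ (n + cyclotomicExponent p)))
      s'.val
    rwa [orderOf_cyclotomicGenerator p n] at h
  have hcast : Units.map (ZMod.castHom (pow_dvd_pow p hle)
      (ZMod (p ^ (n + cyclotomicExponent p)))).toMonoidHom u' =
        Φ (θ, (s'.val : ZMod (p ^ n))) := by
    ext
    rw [Units.coe_map, hΦval, ← hx', hΦ'val]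
    dsimp only
    rw [RingHom.toMonoidHom_eq_coe, MonoidHom.coe_coe, map_mul, map_pow,
      map_natCast (ZMod.castHom (pow_dvd_pow p hle) (ZMod (p ^ (n + cyclotomicExponent p)))),
      ZMod.castHom_apply, PadicInt.cast_toZModPow _ _ hle, ZMod.val_natCast, hpow]
  have hg'u : g' u' = ((s'.val.choose k : ℕ) : ℚ_[p]) := by rw [← hx', hg'Φ']
  have hgu : g (ZMod.castHom (pow_dvd_pow p hle) (ZMod (p ^ (n + cyclotomicExponent p))) u') =
      (((s'.val % p ^ n).choose k : ℕ) : ℚ_[p]) := by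
    have h1 : (ZMod.castHom (pow_dvd_pow p hle) (ZMod (p ^ (n + cyclotomicExponent p))) u' :
        ZMod (p ^ (n + cyclotomicExponent p))) =
        (Units.map (ZMod.castHom (pow_dvd_pow p hle)
          (ZMod (p ^ (n + cyclotomicExponent p)))).toMonoidHom u' :
          ZMod (p ^ (n + cyclotomicExponent p))) := by
      rw [Units.coe_map, RingHom.toMonoidHom_eq_coe, MonoidHom.coe_coe]
    rw [h1, hcast, hgΦ]
    dsimp only
    rw [ZMod.val_natCast]
  have hΔ : ‖g' u' - g (ZMod.castHom (pow_dvd_pow p hle)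
      (ZMod (p ^ (n + cyclotomicExponent p))) u')‖ ≤
      (p : ℝ) ^ (-n : ℤ) / ‖((k.factorial : ℕ) : ℚ_[p])‖ := by
    rw [hg'u, hgu]
    exact norm_choose_sub_choose_le k (Nat.mod_modEq _ _).symm
  rw [← mul_sub, norm_mul]
  calc _ ≤ C * ((p : ℝ) ^ (-n : ℤ) / ‖((k.factorial : ℕ) : ℚ_[p])‖) :=
        mul_le_mul (hC _ _) hΔ (norm_nonneg _) hC0
    _ = _ := by ring

/-- **Convergence of the Riemann sums** of a bounded distribution: `n ↦ RS k n` is Cauchy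
(geometric rate `p^{-n}`), hence converges in `ℚ_p` to its `limUnder`, the `k`-th coefficient
`∫_{ℤ_p^×} (ℓ(x) choose k) dμ` of the transform (Mazur–Tate–Teitelbaum 1986, §I.11–I.13).
[folklore] -/
theorem tendsto_riemannSum_of_distribution
    (hdist : ∀ (n : ℕ) (a : ZMod (p ^ n)),
      ∑ b ∈ Finset.univ.filter (fun b : ZMod (p ^ (n + 1)) ↦
        ZMod.castHom (pow_dvd_pow p n.le_succ) (ZMod (p ^ n)) b = a), μ (n + 1) b = μ n a)
    {C : ℝ} (hC : ∀ (n : ℕ) (a : ZMod (p ^ n)), ‖μ n a‖ ≤ C) (k : ℕ) :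
    Tendsto (fun n ↦ RS k n) atTop (𝓝 (limUnder atTop fun n ↦ RS k n)) := by
  have hC0 : 0 ≤ C := (norm_nonneg _).trans (hC 0 0)
  have hp1 : (1 : ℝ) < p := by exact_mod_cast (Fact.out : p.Prime).one_lt
  have hcauchy : CauchySeq fun n ↦ RS k n := by
    refine cauchySeq_of_le_geometric ((p : ℝ)⁻¹) (C / ‖((k.factorial : ℕ) : ℚ_[p])‖)
      (inv_lt_one_of_one_lt₀ hp1) fun n ↦ ?_
    rw [dist_eq_norm, ← norm_neg, neg_sub, inv_pow, ← zpow_natCast, ← zpow_neg]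
    exact norm_riemannSum_succ_sub_le_of_distribution hRS hdist hC0 hC k n
  exact hcauchy.tendsto_limUnder

/-- **The coefficients of the transform are bounded by the bound of `μ`**:
`‖lim_n RS k n‖ ≤ C` (closed balls of `ℚ_p` are closed) (Mazur–Tate–Teitelbaum 1986, §I.12).
[folklore] -/
theorem norm_limUnder_riemannSum_le_of_distribution
    (hdist : ∀ (n : ℕ) (a : ZMod (p ^ n)),
      ∑ b ∈ Finset.univ.filter (fun b : ZMod (p ^ (n + 1)) ↦
        ZMod.castHom (pow_dvd_pow p n.le_succ) (ZMod (p ^ n)) b = a), μ (n + 1) b = μ n a)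
    {C : ℝ} (hC : ∀ (n : ℕ) (a : ZMod (p ^ n)), ‖μ n a‖ ≤ C) (k : ℕ) :
    ‖limUnder atTop fun n ↦ RS k n‖ ≤ C :=
  le_of_tendsto (tendsto_riemannSum_of_distribution hRS hdist hC k).norm
    (Eventually.of_forall fun n ↦ norm_riemannSum_le hRS hC k n)

/-- **The interpolation property of the transform at a character of `Γ`** (Mazur–Tate–Teitelbaum
1986, §I.13–I.14): if `μ` satisfies the distribution relation and is bounded, then for `χ` mod
`p^{m+1}`, even and of `p`-power order, with `c_k = lim_n RS k n`,
`∑_k c_k (χ(γ) - 1)^k = ∑_{a mod p^{m+1}} χ(a) μ(a + p^{m+1}ℤ_p)`.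
Proof: with `T = χ(γ) - 1` (`‖T‖ < 1` since `χ(γ)` is a `p`-power root of unity), the level-`n`
sums `F_n(T) = ∑_k RS k n T^k = ∑ μ(η γ^s) χ(γ)^s` equal the right-hand side for all
`n ≥ m + 1`
(`finsum_sum_mul_pow_eq_of_distribution`), while `F_n(T) → ∑_k c_k T^k` by dominated convergence
(Tannery's theorem; the domination `‖RS k n T^k‖ ≤ C ‖T‖^k` is the boundedness of `μ`).
[folklore] -/
theorem hasSum_limUnder_riemannSum_mul_pow_of_distribution
    (hdist : ∀ (n : ℕ) (a : ZMod (p ^ n)),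
      ∑ b ∈ Finset.univ.filter (fun b : ZMod (p ^ (n + 1)) ↦
        ZMod.castHom (pow_dvd_pow p n.le_succ) (ZMod (p ^ n)) b = a), μ (n + 1) b = μ n a)
    {C : ℝ} (hC : ∀ (n : ℕ) (a : ZMod (p ^ n)), ‖μ n a‖ ≤ C)
    {m : ℕ} (χ : DirichletCharacter ℂ_[p] (p ^ (m + 1))) (heven : χ.Even)
    (hord : ∃ j : ℕ, orderOf χ = p ^ j) :
    HasSum (fun k : ℕ ↦ algebraMap ℚ_[p] ℂ_[p] (limUnder atTop fun n ↦ RS k n) *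
        (χ (cyclotomicGenerator p : ZMod (p ^ (m + 1))) - 1) ^ k)
      (∑ a : ZMod (p ^ (m + 1)), χ a * algebraMap ℚ_[p] ℂ_[p] (μ (m + 1) a)) := by
  classical
  set T : ℂ_[p] := χ (cyclotomicGenerator p : ZMod (p ^ (m + 1))) - 1 with hT_def
  set V : ℂ_[p] := ∑ a : ZMod (p ^ (m + 1)), χ a * algebraMap ℚ_[p] ℂ_[p] (μ (m + 1) a)
    with hV_def
  have hC0 : 0 ≤ C := (norm_nonneg _).trans (hC 0 0)
  have htend := tendsto_riemannSum_of_distribution hRS hdist hC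
  -- `‖T‖ < 1`
  have hT : ‖T‖ < 1 := by
    obtain ⟨j, hj⟩ := hord
    obtain ⟨v, hv⟩ := isUnit_cyclotomicGenerator_cast p (m + 1)
    refine norm_sub_one_lt_one_of_pow_prime_pow_eq_one (j := j) ?_
    rw [← hv, ← MulChar.pow_apply_coe, ← hj, pow_orderOf_eq_one, MulChar.one_apply_coe]
  have hRSb : ∀ k n, ‖RS k n‖ ≤ C := norm_riemannSum_le hRS hC
  have hcoeff : ∀ k, ‖limUnder atTop fun n ↦ RS k n‖ ≤ C :=
    norm_limUnder_riemannSum_le_of_distribution hRS hdist hC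
  -- Tannery
  have hbound : Summable fun k : ℕ ↦ C * ‖T‖ ^ k :=
    (summable_geometric_of_lt_one (norm_nonneg _) hT).mul_left C
  have hlim : Tendsto (fun n ↦ ∑' k, algebraMap ℚ_[p] ℂ_[p] (RS k n) * T ^ k)
      atTop (𝓝 (∑' k, algebraMap ℚ_[p] ℂ_[p] (limUnder atTop fun n ↦ RS k n) * T ^ k)) := by
    refine tendsto_tsum_of_dominated_convergence hbound (fun k ↦ ?_)
      (Eventually.of_forall fun n k ↦ ?_)
    · exact (((continuous_algebraMap ℚ_[p] ℂ_[p]).tendsto _).comp (htend k)).mul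
        tendsto_const_nhds
    · rw [norm_mul, norm_pow, norm_algebraMap']
      exact mul_le_mul_of_nonneg_right (hRSb k n) (pow_nonneg (norm_nonneg _) _)
  -- the level-`n` sums are eventually constant, equal to `V`
  have hconst : ∀ n, m + 1 ≤ n → ∑' k, algebraMap ℚ_[p] ℂ_[p] (RS k n) * T ^ k = V := by
    intro n hn
    rw [(hasSum_riemannSum_mul_pow hRS n T).tsum_eq]
    have h1T : 1 + T = χ (cyclotomicGenerator p : ZMod (p ^ (m + 1))) := by
      rw [hT_def, add_sub_cancel]
    simp_rw [h1T]
    exact finsum_sum_mul_pow_eq_of_distribution hdist (Nat.succ_pos m) χ heven hord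
      (hn.trans (Nat.le_add_right _ _))
  have hV : Tendsto (fun n ↦ ∑' k, algebraMap ℚ_[p] ℂ_[p] (RS k n) * T ^ k) atTop (𝓝 V) :=
    tendsto_const_nhds.congr' (eventually_atTop.mpr ⟨m + 1, fun n hn ↦ (hconst n hn).symm⟩)
  have huniq : ∑' k, algebraMap ℚ_[p] ℂ_[p] (limUnder atTop fun n ↦ RS k n) * T ^ k = V :=
    tendsto_nhds_unique hlim hV
  have hsumm : Summable fun k : ℕ ↦
      algebraMap ℚ_[p] ℂ_[p] (limUnder atTop fun n ↦ RS k n) * T ^ k := by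
    refine Summable.of_norm_bounded hbound fun k ↦ ?_
    rw [norm_mul, norm_pow, norm_algebraMap']
    exact mul_le_mul_of_nonneg_right (hcoeff k) (pow_nonneg (norm_nonneg _) _)
  exact hsumm.hasSum_iff.mpr huniq

end RiemannSums

/-! ### The transform of a bounded distribution -/

section Transform

/-- **The `p`-adic Mellin transform of a bounded distribution on `ℤ_p^×`** (Mazur–Tate–Teitelbaum,
Invent. Math. 84 (1986), §I.11–I.14; Mazur–Swinnerton-Dyer 1974, §8–§9; Washington, GTM 83, §12.2).
Let `μ : (n : ℕ) → ℤ/p^n → ℚ_p`, `μ n a = μ(a + p^n ℤ_p)`, satisfy the distribution relation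
`∑_{b ≡ a mod p^n} μ(b + p^{n+1}ℤ_p) = μ(a + p^nℤ_p)` and `‖μ(a + p^nℤ_p)‖ ≤ C`. Then there is a
power series `L = L_μ(T) = ∫_{ℤ_p^×} (1 + T)^{ℓ(x)} dμ ∈ ℚ_p⟦T⟧` (`⟨x⟩ = γ^{ℓ(x)}`,
`γ = 1 + p^{e₀} = cyclotomicGenerator p`) such that
1. `‖[T^k] L‖ ≤ C` for all `k` (so `L ∈ Λ ⊗ ℚ_p`, `memIwasawaRat_of_forall_norm_coeff_le`);
2. `L(0) = μ(ℤ_p^×) = ∑_{u ∈ (ℤ/p^{e₀})^×} μ(u + p^{e₀}ℤ_p)`;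
3. for every `m` and every Dirichlet character `χ` mod `p^{m+1}` with values in `ℂ_p` which is a
   character of `Γ = ℤ_p^×/μ_τ` (even and of `p`-power order),
   `∑_k [T^k]L (χ(γ) - 1)^k = ∑_{a mod p^{m+1}} χ(a) μ(a + p^{m+1}ℤ_p) = ∫ χ dμ` in `ℂ_p`
   (MTT §I.13: `L_p(P, χ) = ∑_{a mod p^m} χ(a) μ(a + p^m ℤ_p)` for `χ` of conductor `p^m`,
   `m ≥ 1`; here for every character of `Γ` of level `p^{m+1}`, primitive or not).
The coefficients are `[T^k]L = lim_n RS k n = ∫_{ℤ_p^×} (ℓ(x) choose k) dμ`.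
[cite: MazurTateTeitelbaum1986Invent, §I.13–I.14 (14.3)] -/
theorem exists_powerSeries_of_bounded_distribution {μ : (n : ℕ) → ZMod (p ^ n) → ℚ_[p]}
    (hdist : ∀ (n : ℕ) (a : ZMod (p ^ n)),
      ∑ b ∈ Finset.univ.filter (fun b : ZMod (p ^ (n + 1)) ↦
        ZMod.castHom (pow_dvd_pow p n.le_succ) (ZMod (p ^ n)) b = a), μ (n + 1) b = μ n a)
    {C : ℝ} (hC : ∀ (n : ℕ) (a : ZMod (p ^ n)), ‖μ n a‖ ≤ C) :
    ∃ L : PowerSeries ℚ_[p],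
      (∀ k : ℕ, ‖PowerSeries.coeff k L‖ ≤ C) ∧
      PowerSeries.constantCoeff L =
        ∑ u : (ZMod (p ^ cyclotomicExponent p))ˣ, μ (cyclotomicExponent p) u ∧
      ∀ (m : ℕ) (χ : DirichletCharacter ℂ_[p] (p ^ (m + 1))), χ.Even →
        (∃ j : ℕ, orderOf χ = p ^ j) →
          HasSum (fun k : ℕ ↦ algebraMap ℚ_[p] ℂ_[p] (PowerSeries.coeff k L) *
              (χ (cyclotomicGenerator p : ZMod (p ^ (m + 1))) - 1) ^ k)
            (∑ a : ZMod (p ^ (m + 1)), χ a * algebraMap ℚ_[p] ℂ_[p] (μ (m + 1) a)) := by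
  set RS : ℕ → ℕ → ℚ_[p] := fun k n ↦
    ∑ᶠ η : rootsOfUnity (torsionOrder p) ℤ_[p], ∑ s : ZMod (p ^ n),
      μ (n + cyclotomicExponent p)
          (PadicInt.toZModPow (n + cyclotomicExponent p) ((η : ℤ_[p]ˣ) : ℤ_[p]) *
            (cyclotomicGenerator p : ZMod (p ^ (n + cyclotomicExponent p))) ^ s.val) *
        ((s.val.choose k : ℕ) : ℚ_[p]) with hRS_def
  have hRS : ∀ k n : ℕ, RS k n =
      ∑ᶠ η : rootsOfUnity (torsionOrder p) ℤ_[p], ∑ s : ZMod (p ^ n),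
        μ (n + cyclotomicExponent p)
            (PadicInt.toZModPow (n + cyclotomicExponent p) ((η : ℤ_[p]ˣ) : ℤ_[p]) *
              (cyclotomicGenerator p : ZMod (p ^ (n + cyclotomicExponent p))) ^ s.val) *
          ((s.val.choose k : ℕ) : ℚ_[p]) := fun _ _ ↦ rfl
  refine ⟨PowerSeries.mk fun k ↦ limUnder atTop fun n ↦ RS k n, fun k ↦ ?_, ?_,
    fun m χ heven hord ↦ ?_⟩
  · rw [PowerSeries.coeff_mk]
    exact norm_limUnder_riemannSum_le_of_distribution hRS hdist hC k
  · rw [← PowerSeries.coeff_zero_eq_constantCoeff_apply, PowerSeries.coeff_mk]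
    exact (tendsto_const_nhds.congr fun n ↦
      (riemannSum_zero_of_distribution hRS hdist n).symm).limUnder_eq
  · simp only [PowerSeries.coeff_mk]
    exact hasSum_limUnder_riemannSum_mul_pow_of_distribution hRS hdist hC χ heven hord

end Transform

end Literature.NumberTheory.EllipticCurves
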